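import Summits.QuantumFields.YangMills.Theorems.UnitScaleTiltHistoryTailOfPackageTopPartialIterates
import Summits.QuantumFields.YangMills.Theorems.BalabanUVNodesN08PartialIteratesNecessity
import HarnessLib

/-!
# R3 (cell `ym3-torus`, YM₃ on T³ — a ladder RUNG, NOT d = 4, NOT infinite volume, NOT a mass gap, NOT the Clay problem) —
# **THE TOP-LEVEL KINEMATIC ROW hTop FROM THE TRIVIAL HISTORY'S TOP-LEVEL MASS ENVELOPE hTriv ALONE (v1 currency): in the crux face of record
# ✓`UnitScaleTiltHistoryTailOfPackageMassEnvelope.historyTailL_of_package_of_massEnvelope_of_main (hpkg)(π)(hMain)(hJ)(hTriv)` the row hJ is REDUNDANT**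

Width seat `ym-ust-19936-w3` g19 on crux `stmt-QuantumFields-19936` (`--supports`, helper; THEOREMS ONLY, 0 `def`, 0 `sorry`; CONDITIONAL faces, close nothing).
Sequel of ✓`UV3PinnedStepOrganOfTopPartialIterates` (K-21-TOP: hTop ⇒ the linear mass envelope for every history), ✓`…Knit`, ✓`UnitScaleTiltHistoryTailOfPackageTopPartialIterates`
(K-23-TOP: `HistoryTailL` ⟸ guarded socket ∧ π ∧ hMain ∧ hTop) and of the pub-ymgap N08 file 30 ✓`BalabanUVNodesN08PartialIteratesNecessity` (NECESSITY: the v1 masses FLOOR the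
trivial history, so its mass measure dominates every partial iterated push-forward of Haar INTO ITS LEVEL, `ι_{j,k} ≤ m_k(triv,·)·dU_k`).

THE POINT.  The v1 crux face of record (`ym-ust-19936-w8` g11, ★★OWNER RECORD 17bf) displays, beyond the guarded (α) socket, `π` and the main-term row `hMain`, TWO
UV3-node rows: hJ (the K-uniform a.e. mass envelope on admissible non-trivial histories) and hTriv (the K-uniform a.e. envelope of the TRIVIAL history's mass at the
top level, `∃ A₂, ∀ K, ∀ᵐ W, m_K(triv, W) ≤ e^{A₂}`).  Read at the top level `k = K` of each run, file 30's necessity turns hTriv into the TOP-LEVEL kinematic row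
hTop — `(dU_j)∘(iterFrom (avT3 F K) j n)⁻¹ ≤ e^{A₂⁺}·dU_{j+n}` for `j + n = K` (§1–§2) — and hTop already carries the whole crux through K-21-TOP ∕ K-21 ∕ K-22 ∕ K-23 ∕ K-23-TOP.
Hence (§3) ★★★ `historyTailL_of_package_of_trivMassEnvelope_of_main (hpkg)(π)(hMain)(hTriv) : HistoryTailL` — the face of record WITHOUT ITS hJ ROW; and hTop ⟺ hTriv up to
the factor `K + 1` by kernel (⇐ here; ⇒ ✓`AlphaInputsT3AC.Of.linMassEnvelope_all_of_topHaarPushforward` at `r := triv`).  For the registry's next letter (★★OWNER WORD 68,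
ideator `ym-r3-idea-2`): in v1 currency ONE row suffices — hTop (kinematic: Haar through the `K`-fold block averaging onto the unit torus) or, equivalently up to `log(K+1)`,
hTriv — not the pair {hJ, hTriv}.

CONTENTS.
* §1 (generic `P`, `G`, `AvgAC`, `[RegularGaugeGroup G]`) ★ `map_iterFrom_le_smul_of_massBound_triv` — «`m_k(triv,·) ≤ e^{c}` `dU_k`-a.e.» ⇒ every segment of the averaging ending at
  level `k` pushes Haar to `≤ e^{c}`·Haar (file 30 + ✓`partialIterates_eq_map_iterFrom`).
* §2 (lane) ★★ `AlphaInputsT3AC.Of.topHaarPushforward_of_trivMassEnvelope (h)(γ hγ hγ1)(hTriv) : hTop F` (`c := max A₂ 0`; the package's averaging IS `avT3 F K` and its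
  masses ARE `massRecAC`, `rfl`); ★ `topHaarPushforward_forall_of_trivMassEnvelope (hpkg)(hTriv : ⟨✓p753437's 5th row VERBATIM⟩) : ∀ F, hTop F` (the record `𝔠` and a coupling in
  the window from the guarded socket at `L := F.L`).
* §3 ★★★ `historyTailL_of_package_of_trivMassEnvelope_of_main (hpkg)(π)(hMain)(hTriv) : UnitScaleTilt.HistoryTailL` (K-23-TOP's face at §2); ★ `pinnedHeightTail_of_package_of_trivMassEnvelope_of_main`.

HONEST SCOPE.  CONDITIONAL faces ∕ bookkeeping ([folklore] measure theory over landed theorems); hTriv, hTop, `hMain`, `hpkg` are DISPLAYED hypotheses, NOT proved (hTriv ∕ hTop =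
the N08 loop part for `blockAvg ℰp`, OPEN; `hpkg` = the UV3 node's (α) package, XXL; `hMain` = the EX lane); nothing of `stub_pinnedStep` ∕ `stub_unitEnvelope`, `HistoryTailL`
(19936) unconditionally, the rung `YM3TorusSU2`, any continuum limit, d = 4, infinite volume, a mass gap or Clay is proved here.  YM₃ on T³ is rung R3 of the ladder, not the
Clay problem.

References: T. Bałaban, Commun. Math. Phys. **102** (1985) 255–275 [Balaban1985UV3] ((2) p. 256, (5) p. 257, (41) p. 266, (47) p. 267); T. Bałaban, Commun. Math. Phys.
**98** (1985) 17–51 [Balaban1985Averaging] ((10), (15) p. 19); T. Bałaban, Commun. Math. Phys. **109** (1987) 249–301 [Balaban1987RG1] ((0.11) p. 253).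
-/

set_option autoImplicit false

noncomputable section

namespace Summit.QuantumFields.YangMills.Theorems.UV3TopPartialIteratesOfTrivMassEnvelope

open scoped BigOperators ENNReal
open MeasureTheory
open Literature.MathematicalPhysics.QuantumFieldTheory.Balaban1983to89
open Literature.MathematicalPhysics.QuantumFieldTheory.Balaban1983to89.T4AvgSensitivity (iterFrom)
open Literature.MathematicalPhysics.QuantumFieldTheory.Balaban1983to89.T3ContinuumYM3Torus
open Literature.MathematicalPhysics.QuantumFieldTheory.Balaban1983to89.T3UnitScaleTilt
open Literature.MathematicalPhysics.QuantumFieldTheory.Balaban1983to89.T3UnitLawDensityEML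
open Literature.MathematicalPhysics.QuantumFieldTheory.Balaban1983to89.T3RestrictedUnitDensity
open Literature.MathematicalPhysics.QuantumFieldTheory.Balaban1983to89.T3CruxEstimates
open Literature.MathematicalPhysics.QuantumFieldTheory.Balaban1983to89.T3AlphaInputsAC
open Literature.MathematicalPhysics.QuantumFieldTheory.Balaban1985CMP102
open Literature.MathematicalPhysics.QuantumFieldTheory.Balaban1985CMP102.Setting
open Summit.QuantumFields.Balaban3D.Carriers
open Summit.QuantumFields.Balaban3D.Proofs.Primitives
open Summit.QuantumFields.Balaban3D.Proofs.TowerAC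
open Summit.QuantumFields.Balaban3D.Proofs.StandardAC
open Summit.QuantumFields.Balaban3D.Proofs.InputsAC
open Summit.QuantumFields.Balaban3D.Proofs.MassesAC
open Summit.QuantumFields.YangMills.BalabanUVNodes.N08PartialIteratesSufficiency (exists_partialIterates)
open Summit.QuantumFields.YangMills.BalabanUVNodes.N08PartialIteratesNecessity (partialIterates_le_smul_of_massBound_triv)
open Summit.QuantumFields.YangMills.Theorems.UV3PinnedStepOrganOfTopPartialIterates (partialIterates_eq_map_iterFrom)
open Summit.QuantumFields.YangMills.Theorems.UnitScaleTiltHistoryTailOfPackageTopPartialIterates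
  (pinnedHeightTail_of_package_of_topHaarPushforward_of_main historyTailL_of_package_of_topHaarPushforward_of_main)

/-! ## §1 Generic: the trivial history's a.e. mass letter at a level gives the push-forward letter into that level -/

section Generic

variable {P : Params} {G : Type} [GaugeGroup G] [MeasurableSpace G] [HaarData G] [RegularGaugeGroup G]
  (M₁ : ℕ) (Rcol : ℕ → ℕ) (εL εS : ℕ → ℝ) (av : ∀ j, Averaging P j G) (hav : ∀ j, AvgAC (av j).avg)
include hav

/-- ★ **«`m_k(triv,·) ≤ e^{c}` a.e.» ⇒ EVERY SEGMENT OF THE AVERAGING ENDING AT LEVEL `k` PUSHES HAAR TO AT MOST `e^{c}`·HAAR**: for `k ≤ m + K + 1`, `j + n = k`,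
`(dU_j)∘(iterFrom av j n)⁻¹ ≤ e^{c}·dU_{j+n}` — N08 file 30's necessity ✓`partialIterates_le_smul_of_massBound_triv` (the v1 floor: the trivial history's mass measure dominates every
partial iterate into its level) at the canonical partial iterates, read in push-forward currency by ✓`partialIterates_eq_map_iterFrom`.
[cite: Balaban1985UV3, (2) p.256 + (41) p.266 + (47) p.267 (bookkeeping); Balaban1985Averaging, (10) p.19; Balaban1987RG1, (0.11) p.253] -/
theorem map_iterFrom_le_smul_of_massBound_triv {k : ℕ} (hk : k ≤ P.m + P.K + 1) (c : ℝ)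
    (hm : ∀ᵐ V ∂(fieldMeasure P k G), massRecAC M₁ Rcol εL εS av k (Hist.triv P k) V ≤ Real.exp c)
    (j n : ℕ) (hjn : j + n = k) :
    (fieldMeasure P j G).map (iterFrom av j n) ≤ ENNReal.ofReal (Real.exp c) • fieldMeasure P (j + n) G := by
  obtain ⟨ι, hι0, hιs⟩ := exists_partialIterates av
  rw [← partialIterates_eq_map_iterFrom av hav ι hι0 hιs j n]
  subst hjn
  exact partialIterates_le_smul_of_massBound_triv M₁ Rcol εL εS av hav ι hι0 hιs hk c hm (Nat.le_add_right j n)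

end Generic

/-! ## §2 At the lane: hTop from hTriv -/

section Lane

variable {F : T3Family} {𝔠 : AlphaConsts F.L (suGroupModel 2).N}

/-- ★★ **hTop FROM hTriv** (per family `F`, record `𝔠`, socket `h : Of F 𝔠`, coupling `γ` in the window): IF the trivial history's top-level v1 mass is `≤ e^{A₂}` `dV_K`-a.e. at every run
(§U's ∕ the face of record's hTriv letter, VERBATIM), THEN every segment of the family's pinned block averaging `avT3 F K` ending at the unit torus pushes Haar to `≤ e^{max A₂ 0}`·Haar —
the top-level kinematic row hTop of ★★OWNER WORD 68 (§1 at `k := K ≤ m + K + 1`; the package's averaging IS `avT3 F K` and its masses ARE `massRecAC`, both `rfl`).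
[cite: Balaban1985UV3, (2) p.256 + (41) p.266 + (47) p.267; Balaban1985Averaging, (15) p.19; Balaban1987RG1, (0.11) p.253] -/
theorem _root_.Summit.QuantumFields.YangMills.Theorems.AlphaInputsT3AC.Of.topHaarPushforward_of_trivMassEnvelope
    (h : AlphaInputsT3AC.Of F 𝔠) (γ : ℝ) (hγ : 0 < γ) (hγ1 : γ ≤ (min 𝔠.gamma0 1) ^ 2)
    (hTriv : ∃ A₂ : ℝ, ∀ (K : ℕ), ∀ᵐ W ∂(fieldMeasure (F.P K) K (Matrix.specialUnitaryGroup (Fin 2) ℂ)),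
        (inputOfAC 𝔠.lane (h.pkgAt γ hγ hγ1 K).X (h.pkgAt γ hγ hγ1 K).𝔖).W.mass K (Hist.triv (F.P K) K) W ≤ Real.exp A₂) :
    ∃ c : ℝ, 0 ≤ c ∧ ∀ (K j n : ℕ), j + n = K →
      (fieldMeasure (F.P K) j (Matrix.specialUnitaryGroup (Fin 2) ℂ)).map (iterFrom (avT3 F K) j n) ≤
        ENNReal.ofReal (Real.exp c) • fieldMeasure (F.P K) (j + n) (Matrix.specialUnitaryGroup (Fin 2) ℂ) := by
  obtain ⟨A₂, hA⟩ := hTriv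
  refine ⟨max A₂ 0, le_max_right _ _, fun K j n hjn => ?_⟩
  have hm : ∀ᵐ V ∂(fieldMeasure (F.P K) K (Matrix.specialUnitaryGroup (Fin 2) ℂ)),
      massRecAC 𝔠.lane.carrier.M₁ (rcolOf (T3Scales F γ hγ (hγ1.trans (sq_min_one_le _ 𝔠.gamma0_pos)) K) 𝔠.lane.carrier)
        (eps1Of (T3Scales F γ hγ (hγ1.trans (sq_min_one_le _ 𝔠.gamma0_pos)) K) 𝔠.lane.carrier)
        (epsSOf (T3Scales F γ hγ (hγ1.trans (sq_min_one_le _ 𝔠.gamma0_pos)) K) 𝔠.lane.carrier)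
        (avT3 F K) K (Hist.triv (F.P K) K) V ≤ Real.exp (max A₂ 0) := by
    filter_upwards [hA K] with V hV
    exact hV.trans (Real.exp_le_exp.mpr (le_max_left _ _))
  exact map_iterFrom_le_smul_of_massBound_triv 𝔠.lane.carrier.M₁ _ _ _ (avT3 F K) (avgAC_avT3 F K)
    (show K ≤ (F.P K).m + (F.P K).K + 1 from Nat.le_succ_of_le (Nat.le_add_left _ _)) (max A₂ 0) hm j n hjn

/-- ★ **hTop FOR EVERY FAMILY FROM THE GUARDED SOCKET AND THE FACE OF RECORD'S hTriv ROW** (✓p753437's 5th binder, VERBATIM): at `L := F.L` the guarded socket yields the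
record `𝔠` and `Of F 𝔠` (`1 < F.L` by `T3Family.hL`); read hTriv at the coupling `γ := (min γ₀ 1)²` and apply `topHaarPushforward_of_trivMassEnvelope` (hTop does not mention
`𝔠` or `γ`). [cite: Balaban1985UV3, (2) p.256 + (41) p.266 + (47) p.267; Balaban1987RG1, (0.11) p.253] -/
theorem topHaarPushforward_forall_of_trivMassEnvelope
    (hpkg : ∀ L : ℕ, 1 < L → AlphaInputsT3AC L)
    (hTriv : ∀ (F : T3Family) (𝔠 : AlphaConsts F.L (suGroupModel 2).N) (h : AlphaInputsT3AC.Of F 𝔠) (γ : ℝ) (hγ : 0 < γ)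
      (hγ1 : γ ≤ (min 𝔠.gamma0 1) ^ 2), ∃ A₂ : ℝ, ∀ (K : ℕ),
        ∀ᵐ W ∂(fieldMeasure (F.P K) K (Matrix.specialUnitaryGroup (Fin 2) ℂ)),
          (inputOfAC 𝔠.lane (h.pkgAt γ hγ hγ1 K).X (h.pkgAt γ hγ hγ1 K).𝔖).W.mass K (Hist.triv (F.P K) K) W ≤ Real.exp A₂) :
    ∀ F : T3Family, ∃ c : ℝ, 0 ≤ c ∧ ∀ (K j n : ℕ), j + n = K →
      (fieldMeasure (F.P K) j (Matrix.specialUnitaryGroup (Fin 2) ℂ)).map (iterFrom (avT3 F K) j n) ≤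
        ENNReal.ofReal (Real.exp c) • fieldMeasure (F.P K) (j + n) (Matrix.specialUnitaryGroup (Fin 2) ℂ) := by
  intro F
  obtain ⟨𝔠, h𝔠⟩ := hpkg F.L F.hL.2
  have h : AlphaInputsT3AC.Of F 𝔠 := h𝔠 F rfl
  have hγ0 : 0 < (min 𝔠.gamma0 1) ^ 2 := pow_pos (lt_min 𝔠.gamma0_pos one_pos) 2
  exact h.topHaarPushforward_of_trivMassEnvelope ((min 𝔠.gamma0 1) ^ 2) hγ0 le_rfl (hTriv F 𝔠 h _ hγ0 le_rfl)

end Lane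

/-! ## §3 The crux face of record without its hJ row -/

/-- ★ **THE PINNED HEIGHT TAIL `hP′` FROM THE GUARDED SOCKET, `π`, `hMain` AND hTriv** (K-23-TOP's `pinnedHeightTail_of_package_of_topHaarPushforward_of_main` at §2).
[cite: Balaban1985UV3, Thm 1 (5) p.256, (2) p.256, (6)–(7) p.257, (41) p.266, (47) p.267, (67)–(71) p.273; Balaban1987RG1, (0.11) p.253] -/
theorem pinnedHeightTail_of_package_of_trivMassEnvelope_of_main
    (hpkg : ∀ L : ℕ, 1 < L → AlphaInputsT3AC L)
    (π : ∀ F : T3Family, AlphaInputsT3AC.PolymerT3 F)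
    (hMain : ∀ (F : T3Family) (𝔠 : AlphaConsts F.L (suGroupModel 2).N) (h : AlphaInputsT3AC.Of F 𝔠) (γ : ℝ) (hγ : 0 < γ)
      (hγ1 : γ ≤ (min 𝔠.gamma0 1) ^ 2), ∃ Cm : ℝ, ∀ (K : ℕ) (W : GaugeField (F.P K) K (Matrix.specialUnitaryGroup (Fin 2) ℂ)),
        PlaqSmall (θBal F.L γ 𝔠.b₀ 𝔠.p₀ 0) W →
          (h.dataT3 γ hγ hγ1 (π F)).mainT K K ((h.dataT3 γ hγ hγ1 (π F)).triv K K) W ≤ Cm)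
    (hTriv : ∀ (F : T3Family) (𝔠 : AlphaConsts F.L (suGroupModel 2).N) (h : AlphaInputsT3AC.Of F 𝔠) (γ : ℝ) (hγ : 0 < γ)
      (hγ1 : γ ≤ (min 𝔠.gamma0 1) ^ 2), ∃ A₂ : ℝ, ∀ (K : ℕ),
        ∀ᵐ W ∂(fieldMeasure (F.P K) K (Matrix.specialUnitaryGroup (Fin 2) ℂ)),
          (inputOfAC 𝔠.lane (h.pkgAt γ hγ hγ1 K).X (h.pkgAt γ hγ hγ1 K).𝔖).W.mass K (Hist.triv (F.P K) K) W ≤ Real.exp A₂) :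
    ∀ (L : ℕ), ∃ (b₁' p₁' : ℝ), ∀ (b₀ p₀ : ℝ), b₁' ≤ b₀ → p₁' ≤ p₀ → 0 < b₀ → 2 < p₀ → ∀ (m : ℕ), 0 < m →
      ∃ γ₁ : ℝ, 0 < γ₁ ∧ γ₁ ≤ 1 ∧ ∀ (F : T3Family) (γ : ℝ), F.L = L → 0 < γ → γ ≤ γ₁ →
        ∃ (b p C c : ℝ) (A : ℕ), 0 < b ∧ 1 ≤ p ∧ 0 ≤ C ∧ 0 < c ∧
          ∀ (K j : ℕ), 1 ≤ j → j + 2 ≤ K → j + (K - 1) / m ≤ K → ∀ a : Plaq (F.P K) j,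
          (gibbsK F ℰp γ K).real
              ({U : GaugeField (F.P K) 0 (Matrix.specialUnitaryGroup (Fin 2) ℂ) |
                  θBal F.L γ b₀ p₀ (K - j) ≤ GaugeGroup.dist1 (GaugeField.plaqHol
                    (Averaging.iter (fun i' => BlockAveraging.blockAvg (P := F.P K) (j := i') ℰp) j U) a)} ∩
                {U : GaugeField (F.P K) 0 (Matrix.specialUnitaryGroup (Fin 2) ℂ) | ∀ i, i < j →
                  PlaqSmall (θBal F.L γ b₀ p₀ (K - i))
                    (Averaging.iter (fun i' => BlockAveraging.blockAvg (P := F.P K) (j := i') ℰp) i U)}) ≤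
            C * (F.scheme ℰp γ).β (K - j) ^ A *
              Real.exp (-(c * B10.pFun b p (Real.sqrt (γ * ((F.L : ℝ)⁻¹) ^ (K - j))) ^ 2)) :=
  pinnedHeightTail_of_package_of_topHaarPushforward_of_main hpkg π hMain (topHaarPushforward_forall_of_trivMassEnvelope hpkg hTriv)

/-- ★★★ **`UnitScaleTilt.HistoryTailL` (stmt-QuantumFields-19936) FROM THE GUARDED v1 (α) SOCKET, THE POLYMER FIELDS, THE MAIN-TERM ROW AND hTriv ALONE — the crux face of record
✓`UnitScaleTiltHistoryTailOfPackageMassEnvelope.historyTailL_of_package_of_massEnvelope_of_main` WITHOUT ITS hJ ROW** (its binders `hpkg`, `π`, `hMain`, `hTriv` VERBATIM; hTriv ⇒ hTop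
by §2, then K-23-TOP ✓`historyTailL_of_package_of_topHaarPushforward_of_main`).  CONDITIONAL: closes nothing; hTriv (= hTop up to `log(K+1)`, the N08 loop part, OPEN for
`blockAvg ℰp`), `hMain` (EX lane) and `hpkg` (the UV3 node's (α) package) are DISPLAYED.  R3 = YM₃ on T³, a rung — NOT d = 4, NOT infinite volume, NOT a mass gap, NOT Clay.
[cite: Balaban1985UV3, Thm 1 (5) p.256, (2) p.256, (41) p.266, (47) p.267, (67)–(71) p.273; Balaban1985Averaging, (15) p.19; Balaban1987RG1, (0.11) p.253] -/
theorem historyTailL_of_package_of_trivMassEnvelope_of_main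
    (hpkg : ∀ L : ℕ, 1 < L → AlphaInputsT3AC L)
    (π : ∀ F : T3Family, AlphaInputsT3AC.PolymerT3 F)
    (hMain : ∀ (F : T3Family) (𝔠 : AlphaConsts F.L (suGroupModel 2).N) (h : AlphaInputsT3AC.Of F 𝔠) (γ : ℝ) (hγ : 0 < γ)
      (hγ1 : γ ≤ (min 𝔠.gamma0 1) ^ 2), ∃ Cm : ℝ, ∀ (K : ℕ) (W : GaugeField (F.P K) K (Matrix.specialUnitaryGroup (Fin 2) ℂ)),
        PlaqSmall (θBal F.L γ 𝔠.b₀ 𝔠.p₀ 0) W →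
          (h.dataT3 γ hγ hγ1 (π F)).mainT K K ((h.dataT3 γ hγ hγ1 (π F)).triv K K) W ≤ Cm)
    (hTriv : ∀ (F : T3Family) (𝔠 : AlphaConsts F.L (suGroupModel 2).N) (h : AlphaInputsT3AC.Of F 𝔠) (γ : ℝ) (hγ : 0 < γ)
      (hγ1 : γ ≤ (min 𝔠.gamma0 1) ^ 2), ∃ A₂ : ℝ, ∀ (K : ℕ),
        ∀ᵐ W ∂(fieldMeasure (F.P K) K (Matrix.specialUnitaryGroup (Fin 2) ℂ)),
          (inputOfAC 𝔠.lane (h.pkgAt γ hγ hγ1 K).X (h.pkgAt γ hγ hγ1 K).𝔖).W.mass K (Hist.triv (F.P K) K) W ≤ Real.exp A₂) :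
    Summit.QuantumFields.YangMills.Theses.UnitScaleTilt.HistoryTailL :=
  historyTailL_of_package_of_topHaarPushforward_of_main hpkg π hMain (topHaarPushforward_forall_of_trivMassEnvelope hpkg hTriv)

end Summit.QuantumFields.YangMills.Theorems.UV3TopPartialIteratesOfTrivMassEnvelope

end
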